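import Summits.BirchSwinnertonDyer.Rank1Residual.Additive.GoodModelKodairaProfile
import Summits.BirchSwinnertonDyer.Rank1Residual.Additive.GoodModelOfTypeG
import Summits.BirchSwinnertonDyer.Rank1Residual.Additive.KodairaDictionaryThree
import Summits.BirchSwinnertonDyer.Rank1Residual.Additive.KummerDeuringModelGlobal
import Literature.NumberTheory.EllipticCurves.NeronComponentIndexTypeIIIProofs
import Literature.NumberTheory.EllipticCurves.NeronComponentIndexTypeIIIstarProofs
import Literature.NumberTheory.DiophantineGeometry.TateAlgorithmRingEquivProofs
import Literature.NumberTheory.DiophantineGeometry.TateAlgorithmTameTypesOddProofs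
import HarnessLib

/-!
# The Kummer–Tate good model at a TAME additive `3` of type `III / III*` (the O5 cell `(t′)@3`)
# — row T-CG-SS addendum A3, file A3a-2 (cell `b2b-bsdres`, team n1011; seat n1011-p05 gen 8)

HONEST FRAMING (cell `b2b-bsdres`, run/shared/lean/b2b/bsd-rank1-residual/, verbatim in every
file): the goal of the cell is to DELETE the COMBINATION-SHAPED residual classes of the
Birch–Swinnerton-Dyer formula for ALL analytic-rank `≤ 1` elliptic curves over `ℚ` — "full BSD
formula for every rank `≤ 1` curve in class `C`" assembled STRICTLY from published theorems — so
that the rank-`≤ 1` remainder becomes exactly the CONSTRUCTION-SHAPED classes, which are TYPED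
(missing-input `Prop`s), NOT attempted. This is not "finishing BSD". Team n1011 (X4 ∧ `p = 3`,
§I N10/N11; here the O5 cell O5b = `(t′)@3` of RESIDUAL-MAP §I, mark OPEN and UNCHANGED): research
route; TOOL theorems only; no definition, no named fact; census = EVIDENCE; nothing booked.

## What and why

p07's Kummer–Deuring good model (`KummerDeuringModel(Global)`: `W₀ = ⟨u, 0, 0, 0⟩ · (short normal
form)`, `u^e = p^m`) needs `2, 3 ∈ 𝒪_w^×`, i.e. `p ≥ 5`. On the census cell `(t′)` at `p = 3`
(`SubTprime W 3` ⟺ Kodaira `III / III*` at `3`, tree `subTprime_three_iff_kodairaSymbolAt_III_or_IIIstar`;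
tame, semistability defect `e = 4`, `ord₃ Δ_min ∈ {3, 9}`) this file builds the good model over
the valuation ring `𝒪_w` of `K̄_v` (`v ∋ 3`) from TATE'S NORMAL FORMS instead: the tree's
`exists_smul_of_kodairaSymbolOfMinimal_eq_III` (`a₁, a₂, a₃, a₄ ∈ 𝔪`, `a₆ ∈ 𝔪²`) and
`exists_smul_of_kodairaSymbolOfMinimal_eq_IIIstar` (`𝔪, 𝔪², 𝔪³, 𝔪³, 𝔪⁵`) applied to the minimal
`𝒪_v`-model `W.localMinimalIntegralModel v`, scaled by `u = ι(θ)` (type `III`) resp. `u = ι(θ)³`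
(type `III*`) for a GLOBAL Kummer generator `θ ∈ ℚ̄`, `θ⁴ = 3`, `ι = absClosureEmbedding ℚ ℚ_v`:
the scaled coefficients `a_i / u^i` are `w`-integral (`|a_i|_w ≤ |3|^{k_i} = |ι θ|^{4 k_i} ≤ |u|^i`)
and `Δ / u^{12}` is a unit (`ord₃ Δ = 3` resp. `9`, Ogg: `ord_v Δ_min = m_v + 1` on `III / III*`, the
tree's `ordMinimalDiscriminant_eq_numComponentsAt_add_one_of_kodairaSymbolAt`).

The generic scaled model (valuation bookkeeping + `exists_goodModel_of_kodairaProfile`) is file A3a-1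
`GoodModelKodairaProfile.lean`; here:

* `ringChar_ringOfIntegers_quot_eq`, `kodairaSymbolAt_eq_kodairaSymbolAt_placeOf` (the Kodaira
  symbol at the place `v ∋ p` of `𝓞 ℚ` is the census's symbol at `placeOf p`, both being Tate's
  algorithm over `ℤ_p`: tree `kodairaSymbolAt_eq_padic`), `j_eq_zero_or_padicValRat_three_j_pos`
  (`ord₃ j > 0` from `ord₃ Δ_min` odd — the `p = 3` companion of additive-p2's `p ≥ 5` lemma),
  `padicValInt_minimalDiscriminantInt_of_subTprime_three` (`ord₃ Δ_min ∈ {3, 9}`), and the END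
  **`SubTprime.exists_kummerGoodModel_global_three`**: for `E/ℚ` globally minimal, additive at `3`
  with `SubTprime W 3`, a good model `W₀ = C • E ⊗ K̄_v` with unit discriminant, `C` fixed by every
  local `σ` fixing `ι θ` (`θ⁴ = 3`) — the interface of p07's `exists_kummerGoodModel_global` — and
  with `c̃₄ = 0`, i.e. `j̃ = 0 = 1728` (F-C1 `residue_c₄_eq_zero_of_goodModel`, from `ord₃ j > 0`):
  the residue is SUPERSINGULAR in characteristic `3` (file A3c).

Binder honesty: class columns `Addv W 3`, `SubTprime W 3` only; no named fact. NOT claimed: O6 (wild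
`3`: `3 ∣ e`, no prime-to-`3` fixing level), `p = 2`.

References: J. Tate, *Algorithm for determining the type of a singular fiber* (1975) §§7–8
[Tate1975]; J. H. Silverman, *ATAEC* IV.9.4 Steps 4 and 9, Table 4.1 [SilvermanATAEC1994];
J. H. Silverman, *AEC* VII.1.3, VII.5.5 [SilvermanAEC2009]; J.-P. Serre, Invent. Math. 15 (1972) §5.6
[Serre1972]; R. Greenberg, LNM 1716 Thm. 1.7 [GreenbergLNM1716]; cells/n1011/skel/T-CG-SS-A3.md
(4ee65abe034abfbf).
-/


noncomputable section

open scoped Classical NNReal NumberField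

open WeierstrassCurve

universe u

namespace Summit.BirchSwinnertonDyer.Rank1Residual.Additive.GoodModelLine

open NumberField IsDedekindDomain Field IsDedekindDomain.HeightOneSpectrum IsLocalRing
  Literature.NumberTheory.GaloisRepresentations Literature.NumberTheory.EllipticCurves
  Literature.NumberTheory.EllipticCurves.Rank1Residual
  Literature.NumberTheory.DiophantineGeometry
  Summit.BirchSwinnertonDyer.Rank1Residual.X2.GreenbergVatsalReductionDatum

variable (p : ℕ) [hp : Fact p.Prime] {v : HeightOneSpectrum (𝓞 ℚ)}

/-! ## §3 The Kummer–Tate good model on the cell `(t′)` at `3` -/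

section Three

/-- The residue ring `𝓞 ℚ ⧸ v` at `v ∋ p` has characteristic `p`. [folklore] -/
theorem ringChar_ringOfIntegers_quot_eq (hpv : ((p : ℕ) : 𝓞 ℚ) ∈ v.asIdeal) :
    ringChar (𝓞 ℚ ⧸ v.asIdeal) = p := by
  haveI : Nontrivial (𝓞 ℚ ⧸ v.asIdeal) := Ideal.Quotient.nontrivial_iff.mpr v.isPrime.ne_top
  apply CharP.ringChar_of_prime_eq_zero hp.out
  rw [← map_natCast (Ideal.Quotient.mk v.asIdeal) p, Ideal.Quotient.eq_zero_iff_mem]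
  exact hpv

variable (W : WeierstrassCurve ℚ) [W.IsElliptic]

/-- **The Kodaira symbol at the place `v ∋ p` of `𝓞 ℚ` is the census's symbol at the place `placeOf p`
of `ℤ`**: both are Tate's algorithm over `ℤ_p` (the tree's `kodairaSymbolAt_eq_padic`, for the
Dedekind domains `𝓞 ℚ` and `ℤ`). [cite: Tate1975, §§7–8] -/
theorem kodairaSymbolAt_eq_kodairaSymbolAt_placeOf (hpv : ((p : ℕ) : 𝓞 ℚ) ∈ v.asIdeal) :
    W.kodairaSymbolAt v = W.kodairaSymbolAt (placeOf p) := by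
  have _inst (q : Nat.Primes) : Fact q.1.Prime := ⟨q.2⟩
  have key : ∀ q₁ q₂ : Nat.Primes, q₁ = q₂ →
      (W.baseChange ℚ_[q₁]).kodairaSymbol ℤ_[q₁] = (W.baseChange ℚ_[q₂]).kodairaSymbol ℤ_[q₂] := by
    rintro _ _ rfl; rfl
  have hq₁ : Rat.HeightOneSpectrum.primesEquiv v = ⟨p, hp.out⟩ :=
    Subtype.ext (Rat.HeightOneSpectrum.primesEquiv_eq_of_natCast_mem v hp.out hpv)
  have hq₂ : Rat.HeightOneSpectrum.primesEquiv (R := ℤ) (placeOf p) = ⟨p, hp.out⟩ :=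
    (Rat.HeightOneSpectrum.primesEquiv (R := ℤ)).apply_symm_apply ⟨p, hp.out⟩
  rw [kodairaSymbolAt_eq_padic v W, kodairaSymbolAt_eq_padic (placeOf p) W]
  exact key _ _ (hq₁.trans hq₂.symm)

variable [W.IsGloballyMinimal]

omit hp in
/-- **`ord₃ j > 0` (or `j = 0`) when `ord₃ Δ_min` is odd and `ord₃ j ≥ 0`** (the `p = 3` companion of
additive-p2's `j_eq_or_padicValRat_j_sub_pos_of_not_two_dvd`, where `ord_p 1728 = 0` needed `p ≥ 5`):
if `c₆ = 0` then `j = 1728` and `ord₃ 1728 = 3`; otherwise `ord₃(j − 1728) = 2 ord₃ c₆ − ord₃ Δ` is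
odd, hence `≠ 0`, and `≥ 0` since `ord₃ j ≥ 0`, so `ord₃ j ≥ min(ord₃ (j − 1728), ord₃ 1728) ≥ 1`.
[folklore] -/
theorem j_eq_zero_or_padicValRat_three_j_pos [Fact (Nat.Prime 3)] (hj : 0 ≤ padicValRat 3 W.j)
    (h2 : ¬ 2 ∣ padicValInt 3 W.minimalDiscriminantInt) : W.j = 0 ∨ 0 < padicValRat 3 W.j := by
  by_cases hj0 : W.j = 0
  · exact Or.inl hj0
  right
  have hΔ0 : W.Δ ≠ 0 := W.isUnit_Δ.ne_zero
  have h1728 : padicValRat 3 (1728 : ℚ) = 3 := by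
    rw [show (1728 : ℚ) = ((1728 : ℕ) : ℚ) by norm_num, padicValRat.of_nat]
    norm_cast
    rw [show (1728 : ℕ) = 3 ^ 3 * 64 by norm_num, padicValNat.mul (by norm_num) (by norm_num),
      padicValNat.prime_pow, padicValNat.eq_zero_of_not_dvd (by norm_num)]
  by_cases hc6 : W.c₆ = 0
  · rw [(SpecialJ.j_eq_iff_c₆_eq_zero W).mpr hc6, h1728]; norm_num
  -- `j − 1728 = c₆² / Δ ≠ 0`, of odd valuation `≥ 0`, hence `≥ 1`
  have hsub : W.j - 1728 = W.c₆ ^ 2 / W.Δ := by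
    have hjdef : W.j = W.c₄ ^ 3 / W.Δ := by
      rw [WeierstrassCurve.j, ← coe_Δ', div_eq_inv_mul, Units.val_inv_eq_inv_val]
    rw [hjdef, eq_div_iff hΔ0, sub_mul, div_mul_cancel₀ _ hΔ0]
    linear_combination -W.c_relation
  have hne : W.j - 1728 ≠ 0 := by rw [hsub]; exact div_ne_zero (pow_ne_zero 2 hc6) hΔ0
  have hval : padicValRat 3 (W.j - 1728) = 2 * padicValRat 3 W.c₆ - padicValRat 3 W.Δ := by
    rw [hsub, padicValRat.div (pow_ne_zero 2 hc6) hΔ0, padicValRat.pow]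
    push_cast; ring
  have hnonneg : 0 ≤ padicValRat 3 (W.j - 1728) := by
    have hmin := padicValRat.min_le_padicValRat_add (p := 3) (q := W.j) (r := -1728)
      (by rw [← sub_eq_add_neg]; exact hne)
    rw [← sub_eq_add_neg, padicValRat.neg, h1728] at hmin
    exact le_trans (le_min hj (by norm_num)) hmin
  have hodd : ¬ (2 : ℤ) ∣ padicValRat 3 (W.j - 1728) := by
    rw [hval, padicValRat_Δ_eq W 3]
    rintro ⟨m, hm⟩
    exact h2 (Int.natCast_dvd_natCast.mp ⟨padicValRat 3 W.c₆ - m, by push_cast; linarith⟩)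
  have hone : 1 ≤ padicValRat 3 (W.j - 1728) := by
    rcases hnonneg.lt_or_eq with h | h
    · exact h
    · exact absurd ⟨0, by rw [← h]; ring⟩ hodd
  -- `ord₃ j ≥ min(ord₃ (j − 1728), ord₃ 1728) ≥ 1`
  have hmin := padicValRat.min_le_padicValRat_add (p := 3) (q := W.j - 1728) (r := 1728)
    (by rw [sub_add_cancel]; exact hj0)
  rw [sub_add_cancel, h1728] at hmin
  exact lt_of_lt_of_le (lt_min (by linarith) (by norm_num)) hmin

/-- On the cell `(t′)` at `3` (Kodaira `III / III*`), `ord₃ Δ_min ∈ {3, 9}` (Ogg: `ord Δ = m + 1`,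
Silverman *ATAEC* IV Table 4.1; tree `ordMinimalDiscriminant_eq_numComponentsAt_add_one_of_kodairaSymbolAt`).
[cite: SilvermanATAEC1994, IV.9.4 Steps 4, 9 and Table 4.1 (PDF pp. 344–346, 365)] -/
theorem padicValInt_minimalDiscriminantInt_of_subTprime_three [Fact (Nat.Prime 3)] (hadd : Addv W 3)
    (h : SubTprime W 3) :
    padicValInt 3 W.minimalDiscriminantInt = 3 ∨ padicValInt 3 W.minimalDiscriminantInt = 9 := by
  haveI : PerfectField (IsLocalRing.ResidueField ((placeOf 3).adicCompletionIntegers ℚ)) :=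
    PerfectField.ofFinite
  have h2 : ringChar (ℤ ⧸ (placeOf 3).asIdeal) ≠ 2 := by rw [ringChar_int_quot_placeOf 3]; decide
  have hIII := (subTprime_three_iff_kodairaSymbolAt_III_or_IIIstar W hadd).mp h
  have hord := W.ordMinimalDiscriminant_eq_numComponentsAt_add_one_of_kodairaSymbolAt (placeOf 3) h2
    (hIII.elim Or.inl fun h ↦ Or.inr (Or.inl h))
  rw [ordMinimalDiscriminant_placeOf_eq W 3] at hord
  unfold numComponentsAt at hord
  rcases hIII with h | h <;> rw [h] at hord <;>
    simp only [KodairaSymbol.numComponents] at hord <;> omega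

/-- **THE KUMMER–TATE GOOD MODEL ON `(t′)` AT `3`, WITH A GLOBAL GENERATOR.** `E/ℚ` globally minimal,
ADDITIVE at `3` with `SubTprime W 3` (Kodaira `III / III*`, tame, `e = 4`), `v ∋ 3`,
`ι = absClosureEmbedding ℚ ℚ_v`. There are `θ ∈ ℚ̄` with `θ⁴ = 3`, a change of variables `C` over
`K̄_v` and a model `W₀` over `𝒪_w` with `C • E ⊗ K̄_v = W₀ ⊗ K̄_v` and `Δ(W₀)` a UNIT, such that every
`σ ∈ Γ_{ℚ_v}` fixing `ι θ` fixes `C` (the interface of p07's `exists_kummerGoodModel_global`), and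
`c̃₄(W₀) = 0` — the reduction has `j̃ = 0 = 1728`, SUPERSINGULAR in characteristic `3`. Construction:
Tate's normal form of type `III` (`a₁, a₂, a₃, a₄ ∈ 𝔪`, `a₆ ∈ 𝔪²`, `ord₃ Δ = 3`) scaled by
`u = ι θ`, resp. of type `III*` (`𝔪, 𝔪², 𝔪³, 𝔪³, 𝔪⁵`, `ord₃ Δ = 9`) scaled by `u = ι(θ)³`
(`exists_goodModel_of_kodairaProfile`); `c̃₄ = 0` from `ord₃ j > 0` (F-C1
`residue_c₄_eq_zero_of_goodModel`). O5 stays OPEN; nothing booked.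
[cite: SilvermanATAEC1994, IV.9.4 Steps 4 and 9] [cite: SilvermanAEC2009, Prop. VII.5.5]
[cite: Serre1972, §5.6 (p. 312)] -/
theorem SubTprime.exists_kummerGoodModel_global_three [Fact (Nat.Prime 3)] (hadd : Addv W 3)
    (h : SubTprime W 3) (hpv : ((3 : ℕ) : 𝓞 ℚ) ∈ v.asIdeal) :
    ∃ (θ : AlgebraicClosure ℚ) (C : VariableChange (AlgebraicClosure (v.adicCompletion ℚ)))
      (W₀ : WeierstrassCurve (specVal v).integer)
      (_ : C • (W.baseChange (v.adicCompletion ℚ)).baseChange (AlgebraicClosure (v.adicCompletion ℚ)) =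
        W₀.baseChange (AlgebraicClosure (v.adicCompletion ℚ)))
      (_ : IsUnit W₀.Δ),
      θ ^ 4 = ((3 : ℕ) : AlgebraicClosure ℚ) ∧
      (∀ σ : absoluteGaloisGroup (v.adicCompletion ℚ),
        σ • absClosureEmbedding ℚ (v.adicCompletion ℚ) θ = absClosureEmbedding ℚ (v.adicCompletion ℚ) θ →
        C.map ((absoluteGaloisGroup.toAlgEquiv _ σ :
          AlgebraicClosure (v.adicCompletion ℚ) ≃ₐ[v.adicCompletion ℚ]
            AlgebraicClosure (v.adicCompletion ℚ)) :
          AlgebraicClosure (v.adicCompletion ℚ) →+* AlgebraicClosure (v.adicCompletion ℚ)) = C) ∧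
      IsLocalRing.residue (specVal v).integer W₀.c₄ = 0 := by
  haveI : PerfectField (IsLocalRing.ResidueField (v.adicCompletionIntegers ℚ)) := PerfectField.ofFinite
  set ι := absClosureEmbedding ℚ (v.adicCompletion ℚ) with hι
  -- the global Kummer generator
  obtain ⟨θ, hθ⟩ := IsAlgClosed.exists_pow_nat_eq ((3 : ℕ) : AlgebraicClosure ℚ) (by norm_num : 0 < 4)
  have hθ' : (ι θ) ^ 4 = ((3 : ℕ) : AlgebraicClosure (v.adicCompletion ℚ)) := by
    rw [← map_pow, hθ, map_natCast]
  -- the Kodaira symbol at `v`, on the minimal `𝒪_v`-model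
  have hIII := (subTprime_three_iff_kodairaSymbolAt_III_or_IIIstar W hadd).mp h
  rw [← kodairaSymbolAt_eq_kodairaSymbolAt_placeOf 3 W hpv] at hIII
  have h2 : ringChar (𝓞 ℚ ⧸ v.asIdeal) ≠ 2 := by rw [ringChar_ringOfIntegers_quot_eq 3 hpv]; decide
  have hord := W.ordMinimalDiscriminant_eq_numComponentsAt_add_one_of_kodairaSymbolAt v h2
    (hIII.elim Or.inl fun h ↦ Or.inr (Or.inl h))
  set V := W.localMinimalIntegralModel v with hV
  have hKV : V.kodairaSymbolOfMinimal = .III ∨ V.kodairaSymbolOfMinimal = .IIIstar := by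
    rw [hV, ← kodairaSymbolAt_def]; exact hIII
  -- `Δ(V) = (unit) · 3^n`, `n = ord₃ Δ_min`
  have hmin := W.smul_baseChange_eq_map_localMinimalIntegralModel v
  have hVΔ0 : V.Δ ≠ 0 := by
    intro h0
    have : (V.map (algebraMap (v.adicCompletionIntegers ℚ) (v.adicCompletion ℚ))).Δ = 0 := by
      rw [map_Δ, h0, map_zero]
    rw [← hmin, variableChange_Δ, baseChange, map_Δ] at this
    exact (mul_ne_zero (pow_ne_zero _ (Units.ne_zero _))
      ((map_ne_zero _).mpr W.isUnit_Δ.ne_zero)) this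
  have hirr : Irreducible ((3 : ℕ) : v.adicCompletionIntegers ℚ) := by
    rw [← Rat.HeightOneSpectrum.natGenerator_eq_of_natCast_mem v Nat.prime_three hpv]
    exact Rat.irreducible_natCast_natGenerator v
  obtain ⟨n, w₁, hn⟩ := IsDiscreteValuationRing.eq_unit_mul_pow_irreducible hVΔ0 hirr
  have haddVal : W.ordMinimalDiscriminant v = n := by
    show (IsDiscreteValuationRing.addVal (v.adicCompletionIntegers ℚ) V.Δ).toNat = n
    rw [IsDiscreteValuationRing.addVal_def V.Δ w₁ hirr n hn]
    rfl
  -- the two Tate normal forms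
  have hmain : ∃ (C₀ : VariableChange (AlgebraicClosure (v.adicCompletion ℚ)))
      (W₀ : WeierstrassCurve (specVal v).integer),
      C₀ • (V.map (algebraMap (v.adicCompletionIntegers ℚ) (v.adicCompletion ℚ))).baseChange
          (AlgebraicClosure (v.adicCompletion ℚ)) =
        W₀.baseChange (AlgebraicClosure (v.adicCompletion ℚ)) ∧ IsUnit W₀.Δ ∧
      ∀ ψ : AlgebraicClosure (v.adicCompletion ℚ) ≃ₐ[v.adicCompletion ℚ]
          AlgebraicClosure (v.adicCompletion ℚ), ψ (ι θ) = ι θ →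
        C₀.map (ψ : AlgebraicClosure (v.adicCompletion ℚ) →+* AlgebraicClosure (v.adicCompletion ℚ)) =
          C₀ := by
    rcases hKV with hK | hK
    · -- type `III`: `a₁, a₂, a₃, a₄ ∈ 𝔪`, `a₆ ∈ 𝔪²`, `ord Δ = 3`; scale by `ι θ`
      obtain ⟨D, h₁, h₂, h₃, h₄, -, h₆⟩ :=
        LocalIndex.exists_smul_of_kodairaSymbolOfMinimal_eq_III V hK
      have hn3 : n = 3 := by
        rw [← haddVal, hord]; unfold numComponentsAt
        rw [(kodairaSymbolAt_def v W).trans hK]; rfl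
      refine exists_goodModel_of_kodairaProfile 3 hpv V D (k₁ := 1) (k₂ := 1) (k₃ := 1) (k₄ := 1)
        (k₆ := 2) (n := n) (e := 4) (j := 1) (by norm_num) (by rwa [pow_one]) (by rwa [pow_one])
        (by rwa [pow_one]) (by rwa [pow_one]) h₆ ⟨D.u⁻¹ ^ 12 * w₁, ?_⟩ (by norm_num) (by norm_num)
        (by norm_num) (by norm_num) (by norm_num) (by rw [hn3]) hθ'
      rw [variableChange_Δ, hn, Units.val_mul, Units.val_pow_eq_pow_val, mul_assoc]
    · -- type `III*`: `𝔪, 𝔪², 𝔪³, 𝔪³, 𝔪⁵`, `ord Δ = 9`; scale by `ι(θ)³`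
      obtain ⟨D, h₁, h₂, h₃, h₄, -, h₆⟩ :=
        LocalIndex.exists_smul_of_kodairaSymbolOfMinimal_eq_IIIstar V hK
      have hn9 : n = 9 := by
        rw [← haddVal, hord]; unfold numComponentsAt
        rw [(kodairaSymbolAt_def v W).trans hK]; rfl
      refine exists_goodModel_of_kodairaProfile 3 hpv V D (k₁ := 1) (k₂ := 2) (k₃ := 3) (k₄ := 3)
        (k₆ := 5) (n := n) (e := 4) (j := 3) (by norm_num) (by rwa [pow_one]) h₂ h₃ h₄ h₆
        ⟨D.u⁻¹ ^ 12 * w₁, ?_⟩ (by norm_num) (by norm_num) (by norm_num) (by norm_num) (by norm_num)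
        (by rw [hn9]) hθ'
      rw [variableChange_Δ, hn, Units.val_mul, Units.val_pow_eq_pow_val, mul_assoc]
  obtain ⟨C₀, W₀, hW₀, hΔ, hfix⟩ := hmain
  -- compose with the minimal change of variables over `K_v`
  set Cmin := ((W.baseChange (v.adicCompletion ℚ)).exists_isMinimal (v.adicCompletionIntegers ℚ)).choose
    with hCmin
  set C := C₀ * Cmin.map (algebraMap (v.adicCompletion ℚ) (AlgebraicClosure (v.adicCompletion ℚ)))
    with hC
  have hmodel : C • (W.baseChange (v.adicCompletion ℚ)).baseChange (AlgebraicClosure (v.adicCompletion ℚ)) =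
      W₀.baseChange (AlgebraicClosure (v.adicCompletion ℚ)) := by
    rw [hC, mul_smul, ← VariableChange.baseChange_smul_eq, hmin, hW₀]
  have hj : 0 ≤ padicValRat 3 W.j := not_lt.mp h.1
  have h2Δ : ¬ 2 ∣ padicValInt 3 W.minimalDiscriminantInt := by
    rcases padicValInt_minimalDiscriminantInt_of_subTprime_three W hadd h with h | h <;> rw [h] <;> omega
  refine ⟨θ, C, W₀, hmodel, hΔ, hθ, fun σ hσ ↦ ?_,
    residue_c₄_eq_zero_of_goodModel W 3 hpv hmodel hΔ (j_eq_zero_or_padicValRat_three_j_pos W hj h2Δ)⟩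
  -- `σ` fixes `C`: `C₀` by `hfix` (`σ` fixes `ι θ`), `Cmin` has entries in `K_v`
  set ψ := (absoluteGaloisGroup.toAlgEquiv _ σ :
    AlgebraicClosure (v.adicCompletion ℚ) ≃ₐ[v.adicCompletion ℚ] AlgebraicClosure (v.adicCompletion ℚ))
    with hψ
  have hψθ : ψ (ι θ) = ι θ := hσ
  have hψalg : (ψ : AlgebraicClosure (v.adicCompletion ℚ) →+* AlgebraicClosure (v.adicCompletion ℚ)).comp
      (algebraMap (v.adicCompletion ℚ) (AlgebraicClosure (v.adicCompletion ℚ))) =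
      algebraMap (v.adicCompletion ℚ) (AlgebraicClosure (v.adicCompletion ℚ)) := by
    ext x; exact ψ.commutes x
  have hCmin' : (Cmin.map (algebraMap (v.adicCompletion ℚ) (AlgebraicClosure (v.adicCompletion ℚ)))).map
      (ψ : AlgebraicClosure (v.adicCompletion ℚ) →+* AlgebraicClosure (v.adicCompletion ℚ)) =
      Cmin.map (algebraMap (v.adicCompletion ℚ) (AlgebraicClosure (v.adicCompletion ℚ))) := by
    rw [VariableChange.map_map, hψalg]
  rw [hC, show (C₀ * Cmin.map (algebraMap (v.adicCompletion ℚ) (AlgebraicClosure (v.adicCompletion ℚ)))).map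
      (ψ : AlgebraicClosure (v.adicCompletion ℚ) →+* AlgebraicClosure (v.adicCompletion ℚ)) =
      C₀.map (ψ : AlgebraicClosure (v.adicCompletion ℚ) →+* AlgebraicClosure (v.adicCompletion ℚ)) *
        (Cmin.map (algebraMap (v.adicCompletion ℚ) (AlgebraicClosure (v.adicCompletion ℚ)))).map (ψ : AlgebraicClosure (v.adicCompletion ℚ) →+* AlgebraicClosure (v.adicCompletion ℚ))
    from map_mul (VariableChange.mapHom (ψ : AlgebraicClosure (v.adicCompletion ℚ) →+* AlgebraicClosure (v.adicCompletion ℚ))) C₀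
      (Cmin.map (algebraMap (v.adicCompletion ℚ) (AlgebraicClosure (v.adicCompletion ℚ)))), hfix ψ hψθ, hCmin']

end Three

end Summit.BirchSwinnertonDyer.Rank1Residual.Additive.GoodModelLine

end
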